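import Summits.HodgeConjecture.HodgeConjecture.Theorems.VHCAbelianSchemesRoadEllipticPowerAnchors
import HarnessLib

/-!
# Road b02 (`VHCAbelianSchemesRoad`) × the André column — CARRIERS BY CODIMENSION: `HCAtDim g` from carriers for algebraic classes of
# codimension `2 ≤ p ≤ g − 2` only; ABELIAN FOURFOLDS FROM CODIMENSION-2 CARRIERS at CM 8-folds and at elliptic powers

research route, not a corollary; conditional on HC_CM plus one named minimal statement.

PART AB-d (`VHCAbelianSchemesRoadEllipticPowerAnchors`) proved `HC_CM` from the refined Lemmes 6.3.2–6.3.3 (clause (ii) recorded: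
`Andre1996.andre1996_cmHodgeClasses_ellipticPowerPencils`), the door and carriers for ALGEBRAIC classes at elliptic-power anchors in EVERY
mid-range codimension, and `HC_AV` with `HC_CM` idle. André's chain PRESERVES THE CODIMENSION: a class of codimension `p` on the `g`-fold `A`
is moved (Lemme 6.3.1) to a class of codimension `p` on a CM `2g`-fold, whose classes of codimension `p` are (Lemme 6.3.2) pull-backs of
codimension-`p` classes on `B_j`, each moved (Lemme 6.3.3) along a pencil of some relative dimension `d` to a codimension-`p` class on an
elliptic power. So the carrier demand is GRADED BY `p`; this file records the graded rows:

* §1 `mem_algebraicClasses_cm_codim_of_ellipticPowerPencils_of_anchoredCarrierAt` — for a FIXED `p ≥ 2`: refined fact ∧ door ∧ carriers for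
  algebraic codimension-`p` classes at elliptic-power anchors of every dimension `d ≥ p + 2` ⟹ every rational `(p,p)` class on every CM
  abelian variety is algebraic (`HC_CM` in codimension `p`).
* §2 `mem_algebraicClasses_codim_of_cmAnchoredPencil_of_cmCodim_of_cmAlgebraicCarrierAt` — for ONE `g`-fold `A` and `2 ≤ p ≤ g − 2`: Lemme 6.3.1
  ∧ door ∧ «`HC_CM` in codimension `p` at dimension `2g`» ∧ CM-algebraic carriers at `(2g, p)` ⟹ every rational `(p,p)` class on `A` is algebraic.
* §3 **`hcAtDim_of_codim_carriers`** — `HCAtDim g` ⟸ Lemme 6.3.1 ∧ refined #22 ∧ door ∧ CM-algebraic carriers at `(2g, p)` ∧ elliptic-power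
  algebraic carriers at `(d, p)` (`d ≥ p + 2`), BOTH ONLY FOR `2 ≤ p ≤ g − 2`; and the first instance
  **`hcAtDim_four_of_codimTwo_carriers`**: HC FOR ALL ABELIAN FOURFOLDS ⟸ Lemme 6.3.1 ∧ refined #22 ∧ door ∧ «twisted carriers for ALGEBRAIC
  2-CYCLES on (i) polarised CM abelian 8-folds and (ii) polarised abelian varieties of dimension `≥ 4` isogenous to powers of elliptic
  curves» — EVERYTHING IN CODIMENSION 2, where Buchweitz–Flenner admissibility of a vector bundle `F` with `I = {2}` is the injectivity of
  ONE map `σ₁ : Ext²(F, F) → H³(Ω¹)` (`ξ ↦ tr(At(F) ∘ ξ)`) and the datum reads `(exp B₀ · ch F)₂ = a·w + c·θ²`; `HC_CM` idle, cell-free,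
  residual-free; twisted-door form per `C`. (Abelian fourfolds are `HCUpToDim 5` modulo Markman 2025, UNREFEREED; this row is fact-free.)

HONEST: every carrier statement is OPEN and NOT implied by the Hodge conjecture; Lemme 6.3.1 and the refined Lemmes 6.3.2–6.3.3 are THEOREMS
in print entering BY NAME; the door is the road's binder. Nothing here says any carrier, door, `HC_CM`, `HC_AV` or HC holds. References:
[cite: Andre1996Motifs, §6.3 Lemmes 6.3.1–6.3.3 (pp. 31–33)] [cite: vanGeemen1994HodgeAV, Thm. 4.3] [cite: BuchweitzFlenner2003, Def. 4.1, §5 Thm. 5.1]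
[cite: Bloch1972Semiregularity, Remark (7.5)] [cite: MoonenZarhin1999LowDim, Thm. 0.1] [cite: Milne1999, §7 p. 72].
-/

noncomputable section

open CategoryTheory CategoryTheory.Limits AlgebraicGeometry Topology

namespace Summit.HodgeConjecture.HodgeConjecture.Ring2.SemiregularRepresentatives

-- the cell's namespace repeats the summit name (`Summit.HodgeConjecture.HodgeConjecture…`), as in every `Ring2*` file
set_option linter.dupNamespace false

open Literature.AlgebraicGeometry Literature.AlgebraicGeometry.Motives
open Literature.AlgebraicGeometry.HodgeTheory
open Literature.AlgebraicTopology.SingularHomology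
open Literature.Barriers.HodgeConjecture (divisorClassesSpan)
open Literature.AlgebraicGeometry.Andre1996 (andre1996_cmAnchoredPencil andre1996_cmHodgeClasses_ellipticPowerPencils
  IsCMAnchoredPencilFor IsAlgebraicallyAnchoredPencilFor compactPencil_dim_eq_of_iso compactPencil_exists_abelianVariety_fiber_dim)
open Literature.AlgebraicGeometry.Milne1999 (IsOfCMType CMHodgeHypothesisAt)
open Summit.HodgeConjecture.HodgeConjecture.Ring2.Binders
open Summit.HodgeConjecture.HodgeConjecture.Ring2.ClassTargets
open Summit.Ventures.HSemireg (ObjClass LocalVariationalHodgeFor)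

variable {𝒪 : ObjClass}

/-! ## §1 `HC_CM` in a fixed codimension from elliptic-power carriers in that codimension -/

/-- **`HC_CM` IN CODIMENSION `p` (fixed, `p ≥ 2`) from the refined Lemmes 6.3.2–6.3.3, the door and carriers for ALGEBRAIC codimension-`p`
classes at elliptic-power anchors of every dimension `d ≥ p + 2`**: every rational `(p,p)` class on every CM abelian variety is algebraic.
(André's chain preserves the codimension; on a `d`-fold with `d ≤ p + 1` the class is Lefschetz.) [cite: Andre1996Motifs, §6.3 b), c), Lemme 6.3.3 (ii) (pp. 32–33)]
[cite: vanGeemen1994HodgeAV, Thm. 4.3] [cite: Bloch1972Semiregularity, Remark (7.5)] [cite: Milne1999, §7 p. 72] -/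
theorem mem_algebraicClasses_cm_codim_of_ellipticPowerPencils_of_anchoredCarrierAt (h₂₂ : andre1996_cmHodgeClasses_ellipticPowerPencils)
    (hT : LocalVariationalHodgeFor 𝒪) {p : ℕ} (hp : 2 ≤ p)
    (hcar : ∀ d : ℕ, p + 2 ≤ d → AnchoredCarrierAt 𝒪 d p
      (fun X θ ↦ (∃ (A₀ E₀ : AbelianVariety ℂ) (N : ℕ), A₀.dim = d ∧ E₀.dim = 1 ∧ A₀.IsIsogenous (E₀.powSucc N) ∧
        Nonempty (A₀.X ≅ X)) ∧ IsPolarizationClass d X θ)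
      (fun X _ ↦ (algebraicClasses X p : Set (complexBetti X (2 * p)))))
    (B : AbelianVariety ℂ) (hCM : IsOfCMType B) (c : complexBetti B.X (2 * p)) (hc : IsRationalClass c)
    (hpp : IsOfHodgeType B.dim B.X (2 * p) p p c) : c ∈ algebraicClasses B.X p := by
  have hB : IsSmoothProjective B.dim B.X := AbelianVariety.isSmoothProjective_holds
  refine (Submodule.span_le.mpr ?_) (h₂₂ B hB hCM p (by omega) c hc hpp)
  rintro _ ⟨B', g, w, d, 𝒳, S, f, ⟨hf, s₁, _, W, A₁, e₁, g', q, hW, hq, hgw, -⟩, ⟨s₀, A₀, E₀, N, hE₀, hiso, ⟨e₀⟩⟩, rfl⟩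
  have h₁ : complexBetti.map (fiberι f s₁) (2 * p) W ∈ algebraicClasses (fiberOver f s₁) p := by
    by_cases hoff : p ≤ 1 ∨ d ≤ p + 1
    · exact (mem_algebraicClasses_and_divisorClassesSpan_of_offMidRange (hf.isSmoothProjectiveFamily.isSmoothProjective s₁) hoff _
        (hW s₁).1 (hW s₁).2).1
    · exact mem_algebraicClasses_compactPencil_of_ellipticPowerFibre_of_anchoredCarrierAt hT (hcar d (by omega)) hf hE₀ hiso e₀ W hW s₁
  have h₂ : complexBetti.map e₁.hom (2 * p) (complexBetti.map (fiberι f s₁) (2 * p) W) ∈ algebraicClasses A₁.X p :=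
    (mem_algebraicClasses_map_iff_of_iso e₁).2 h₁
  have h₃ : (q : ℂ) • w ∈ algebraicClasses B'.X p := by
    rw [← hgw]
    exact map_mem_algebraicClasses_of_abelianVariety AbelianVariety.isSmoothProjective_holds A₁ g'.hom.hom.hom h₂
  exact map_mem_algebraicClasses_of_abelianVariety hB B' g.hom.hom.hom ((Submodule.smul_mem_iff _ (Rat.cast_ne_zero.2 hq)).1 h₃)

/-! ## §2 One abelian variety, one codimension -/

/-- **Codimension `p` on ONE abelian `g`-fold `A` from Lemme 6.3.1, the door, «`HC_CM` in codimension `p` at dimension `2g`» and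
CM-algebraic carriers at `(2g, p)`**: every rational `(p,p)` class on `A` is algebraic (used for `2 ≤ p ≤ g − 2`; off that range the class is
Lefschetz anyway). [cite: Andre1996Motifs, Lemme 6.3.1 (p. 31) and §6.3 a) (p. 33)]
[cite: Abdulali1994FamiliesAV, Lemma 6.2 (p. 1131)] [cite: Bloch1972Semiregularity, Remark (7.5)] -/
theorem mem_algebraicClasses_codim_of_cmAnchoredPencil_of_cmCodim_of_cmAlgebraicCarrierAt (h₂₁ : andre1996_cmAnchoredPencil)
    (hT : LocalVariationalHodgeFor 𝒪) (A : AbelianVariety ℂ) {p : ℕ}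
    (hCM : ∀ A₀ : AbelianVariety ℂ, A₀.dim = 2 * A.dim → IsOfCMType A₀ → ∀ c' : complexBetti A₀.X (2 * p), IsRationalClass c' →
      IsOfHodgeType A₀.dim A₀.X (2 * p) p p c' → c' ∈ algebraicClasses A₀.X p)
    (hcar : AnchoredCarrierAt 𝒪 (2 * A.dim) p
      (fun X θ ↦ (∃ A₀ : AbelianVariety ℂ, A₀.dim = 2 * A.dim ∧ IsOfCMType A₀ ∧ Nonempty (A₀.X ≅ X)) ∧
        IsPolarizationClass (2 * A.dim) X θ)
      (fun X _ ↦ (algebraicClasses X p : Set (complexBetti X (2 * p)))))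
    (c : complexBetti A.X (2 * p)) (hc : IsRationalClass c) (hpp : IsOfHodgeType A.dim A.X (2 * p) p p c) :
    c ∈ algebraicClasses A.X p := by
  have hA : IsSmoothProjective A.dim A.X := AbelianVariety.isSmoothProjective_holds
  obtain ⟨𝒳, S, f, hf, s, t, W, A₁, A₀, e₁, g, q, hW, hq, hgc, ⟨e₀⟩, hA₀⟩ := h₂₁ A hA p c hc hpp
  have hdim : A₀.dim = 2 * A.dim := compactPencil_dim_eq_of_iso hf e₀
  -- `HC_CM` in codimension `p` at `A₀`, moved to the fibre `𝒳_t` along `e₀`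
  have h₀ : complexBetti.map (fiberι f t) (2 * p) W ∈ algebraicClasses (fiberOver f t) p := by
    have hHC := hCM A₀ hdim hA₀
    rw [hdim] at hHC
    exact (forall_hodgeClass_mem_algebraicClasses_iff_of_iso e₀ p).1 hHC _ (hW t).1 (hW t).2
  have h₁ : complexBetti.map (fiberι f s) (2 * p) W ∈ algebraicClasses (fiberOver f s) p :=
    mem_algebraicClasses_compactPencil_of_anchoredCarrierAt_of_hasServedFibre hT hcar hf W hW
      (hasServedFibre_compactPencil_of_cmFibre_of_mem_algebraicClasses hf A₀ e₀ hA₀ W h₀) s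
  have h₂ : complexBetti.map e₁.hom (2 * p) (complexBetti.map (fiberι f s) (2 * p) W) ∈ algebraicClasses A₁.X p :=
    (mem_algebraicClasses_map_iff_of_iso e₁).2 h₁
  have h₃ : (q : ℂ) • c ∈ algebraicClasses A.X p := by
    rw [← hgc]
    exact map_mem_algebraicClasses_of_abelianVariety hA A₁ g.hom.hom.hom h₂
  exact (Submodule.smul_mem_iff _ (Rat.cast_ne_zero.2 hq)).1 h₃

/-! ## §3 `HCAtDim g` from carriers in codimensions `2 ≤ p ≤ g − 2` only; abelian fourfolds from codimension-2 carriers -/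

/-- **`HCAtDim g` FROM CARRIERS IN CODIMENSIONS `2 ≤ p ≤ g − 2` ONLY** (cell-free, residual-free, `HC_CM` idle): Lemme 6.3.1 ∧ the refined
Lemmes 6.3.2–6.3.3 ∧ the door for `𝒪` ∧ CM-algebraic carriers at `(2g, p)` ∧ elliptic-power algebraic carriers at `(d, p)` for all `d ≥ p + 2` —
each only for `2 ≤ p ≤ g − 2` — ⟹ HC for every complex abelian variety of dimension `g` (codimensions `≤ 1`, `≥ g − 1` are Lefschetz).
[cite: Andre1996Motifs, §6.3 Lemmes 6.3.1–6.3.3 (pp. 31–33)] [cite: vanGeemen1994HodgeAV, Thm. 4.3] [cite: Bloch1972Semiregularity, Remark (7.5)] -/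
theorem hcAtDim_of_codim_carriers (g : ℕ) (h₂₁ : andre1996_cmAnchoredPencil) (h₂₂ : andre1996_cmHodgeClasses_ellipticPowerPencils)
    (hT : LocalVariationalHodgeFor 𝒪)
    (hcm : ∀ p : ℕ, 2 ≤ p → p + 2 ≤ g → AnchoredCarrierAt 𝒪 (2 * g) p
      (fun X θ ↦ (∃ A₀ : AbelianVariety ℂ, A₀.dim = 2 * g ∧ IsOfCMType A₀ ∧ Nonempty (A₀.X ≅ X)) ∧ IsPolarizationClass (2 * g) X θ)
      (fun X _ ↦ (algebraicClasses X p : Set (complexBetti X (2 * p)))))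
    (hell : ∀ p d : ℕ, 2 ≤ p → p + 2 ≤ g → p + 2 ≤ d → AnchoredCarrierAt 𝒪 d p
      (fun X θ ↦ (∃ (A₀ E₀ : AbelianVariety ℂ) (N : ℕ), A₀.dim = d ∧ E₀.dim = 1 ∧ A₀.IsIsogenous (E₀.powSucc N) ∧
        Nonempty (A₀.X ≅ X)) ∧ IsPolarizationClass d X θ)
      (fun X _ ↦ (algebraicClasses X p : Set (complexBetti X (2 * p))))) :
    HCAtDim g := by
  intro A hAg
  have hg : A.dim = g := hAg
  subst hg
  have hA : IsSmoothProjective A.dim A.X := AbelianVariety.isSmoothProjective_holds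
  refine (hodgeConjectureFor_iff_of_isSmoothProjective nonempty_hodgeModel_holds hA).2 ?_
  intro p c hc hpp
  by_cases hoff : p ≤ 1 ∨ A.dim ≤ p + 1
  · exact (mem_algebraicClasses_and_divisorClassesSpan_of_offMidRange hA hoff c hc hpp).1
  exact mem_algebraicClasses_codim_of_cmAnchoredPencil_of_cmCodim_of_cmAlgebraicCarrierAt h₂₁ hT A
    (fun A₀ _ hA₀ c' hc' hpp' ↦ mem_algebraicClasses_cm_codim_of_ellipticPowerPencils_of_anchoredCarrierAt h₂₂ hT (by omega)
      (fun d hd ↦ hell p d (by omega) (by omega) hd) A₀ hA₀ c' hc' hpp')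
    (hcm p (by omega) (by omega)) c hc hpp

/-- **HC FOR ALL COMPLEX ABELIAN FOURFOLDS FROM CODIMENSION-2 CARRIERS ONLY** (fact-free; cell-free; residual-free; `HC_CM` idle): Lemme 6.3.1
∧ the refined Lemmes 6.3.2–6.3.3 ∧ the door for `𝒪` ∧ «`𝒪`-carriers with sides on the `θ`-ray for rational ALGEBRAIC 2-CYCLE CLASSES on
(i) polarised CM abelian 8-folds and (ii) polarised abelian `d`-folds, `d ≥ 4`, isogenous to powers of elliptic curves» ⟹ `HCAtDim 4`. For the
road's twisted door with `Adm ∋ bfSingleAdmissible` and `I = {2}` a datum is a vector bundle `F` with `σ₁ : Ext²(F,F) → H³(Ω¹)`,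
`ξ ↦ tr(At(F) ∘ ξ)`, injective and a rational algebraic `B`-field `B₀` with `(exp B₀ · ch F)₂ = a·w + c·θ²`, `a ≠ 0` — the find-the-sheaf
form of the first open instance of the André column. [cite: Andre1996Motifs, §6.3 (pp. 31–33)] [cite: BuchweitzFlenner2003, Def. 4.1 and §5 Thm. 5.1]
[cite: vanGeemen1994HodgeAV, Thm. 4.3] [cite: MoonenZarhin1999LowDim, Thm. 0.1] -/
theorem hcAtDim_four_of_codimTwo_carriers (h₂₁ : andre1996_cmAnchoredPencil) (h₂₂ : andre1996_cmHodgeClasses_ellipticPowerPencils)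
    (hT : LocalVariationalHodgeFor 𝒪)
    (hcm : AnchoredCarrierAt 𝒪 8 2
      (fun X θ ↦ (∃ A₀ : AbelianVariety ℂ, A₀.dim = 8 ∧ IsOfCMType A₀ ∧ Nonempty (A₀.X ≅ X)) ∧ IsPolarizationClass 8 X θ)
      (fun X _ ↦ (algebraicClasses X 2 : Set (complexBetti X (2 * 2)))))
    (hell : ∀ d : ℕ, 4 ≤ d → AnchoredCarrierAt 𝒪 d 2
      (fun X θ ↦ (∃ (A₀ E₀ : AbelianVariety ℂ) (N : ℕ), A₀.dim = d ∧ E₀.dim = 1 ∧ A₀.IsIsogenous (E₀.powSucc N) ∧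
        Nonempty (A₀.X ≅ X)) ∧ IsPolarizationClass d X θ)
      (fun X _ ↦ (algebraicClasses X 2 : Set (complexBetti X (2 * 2))))) :
    HCAtDim 4 := by
  refine hcAtDim_of_codim_carriers 4 h₂₁ h₂₂ hT (fun p hp2 hp4 ↦ ?_) fun p d hp2 hp4 hd ↦ ?_
  · obtain rfl : p = 2 := by omega
    exact hcm
  · obtain rfl : p = 2 := by omega
    exact hell d hd

/-- **Twisted-door form of the fourfold row, per Chern character theory `C`** (`TwistedPerfectDoorVHC C Adm`).
[cite: Andre1996Motifs, §6.3 (pp. 31–33)] [cite: Pridham2024Semiregularity, Cor. 2.25 and Rem. 2.27] [cite: BuchweitzFlenner2003, §5 Thm. 5.1] -/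
theorem hcAtDim_four_of_twistedPerfectDoorVHC_of_codimTwo_carriers {C : ChernCharacterBetti} {Adm : PerfectAdmissibility}
    (h₂₁ : andre1996_cmAnchoredPencil) (h₂₂ : andre1996_cmHodgeClasses_ellipticPowerPencils) (hT : TwistedPerfectDoorVHC C Adm)
    (hcm : AnchoredCarrierAt (twistedReflexiveClass C Adm) 8 2
      (fun X θ ↦ (∃ A₀ : AbelianVariety ℂ, A₀.dim = 8 ∧ IsOfCMType A₀ ∧ Nonempty (A₀.X ≅ X)) ∧ IsPolarizationClass 8 X θ)
      (fun X _ ↦ (algebraicClasses X 2 : Set (complexBetti X (2 * 2)))))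
    (hell : ∀ d : ℕ, 4 ≤ d → AnchoredCarrierAt (twistedReflexiveClass C Adm) d 2
      (fun X θ ↦ (∃ (A₀ E₀ : AbelianVariety ℂ) (N : ℕ), A₀.dim = d ∧ E₀.dim = 1 ∧ A₀.IsIsogenous (E₀.powSucc N) ∧
        Nonempty (A₀.X ≅ X)) ∧ IsPolarizationClass d X θ)
      (fun X _ ↦ (algebraicClasses X 2 : Set (complexBetti X (2 * 2))))) :
    HCAtDim 4 :=
  hcAtDim_four_of_codimTwo_carriers h₂₁ h₂₂ ((twistedPerfectDoorVHC_iff_localVariationalHodgeFor C Adm).1 hT) hcm hell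

end Summit.HodgeConjecture.HodgeConjecture.Ring2.SemiregularRepresentatives

end
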